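import Summits.Ventures.PercRepro.Night2StarTwoLong

/-!
# PercRepro — night-2: eight non-triangle points, or twenty-four mixed pairs, give `(★)` (blind cell pub-perc-repro, night-2 gen 1)

A NON-TRIANGLE point of a basis `B` is an `x ∈ G ∖ B` whose fundamental circuit has `≥ 4` points, `m(B ∪ {x}) + 3 ≤ q`; its
single pays `≥ (c − 3)/(c(q + 1)) ≥ 1/(4(q + 1))` (`nontriangle_term_ge`), so eight of them pay `2/(q + 1)`
(`rec_ge_of_eight_nontriangle`). A MIXED pair `{x, y}` (`x` a triangle point, `y` a non-triangle point) pays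
`≥ [q/(1 + m_y) − Φ]/(3 c_y) ≥ (c_y − 3)/(3c_y (q + 1)) ≥ 1/(12(q + 1))` (`mixed_pair_term_ge`, from `pair_term_ge`), so
twenty-four of them pay `2/(q + 1)` (`rec_ge_of_mixed_pairs`). Both are the «singles pay» / «pairs pay» clauses of
`proofs/NIGHT-2-star.md` §5 in kernel form.
-/

namespace PercRepro.Star

open Finset ThmH SixFour GenQ

variable {α : Type*} [DecidableEq α] {M : Matroid α} [M.Finite]

/-- A non-triangle single pays `≥ 1/(4(q + 1))`. -/
theorem nontriangle_term_ge (hs : Simple M) {G B : Finset α} {q : ℕ} (hG : G ⊆ gr M)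
    (hrG : M.eRk (G : Set α) = (q : ℕ∞)) (hB : B ∈ Bq M G q) (hq : 1 ≤ q) {x : α} (hx : x ∈ G \ B)
    (hm : mTr M (insert x B) + 3 ≤ q) :
    1 / (4 * ((q : ℚ) + 1)) ≤ surplus M G q (insert x B) / (bIn M G q (insert x B) : ℚ) := by
  obtain ⟨hSx, hcx⟩ := insert_mem_SNq hrG hB hx
  have h1 := single_term_ge hs hG (mem_SNq.1 hSx).1 (mem_SNq.1 hSx).2.1 hq hcx
  set m : ℚ := (mTr M (insert x B) : ℚ) with hm_def
  have hm0 : (0 : ℚ) ≤ m := by rw [hm_def]; positivity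
  have hmq : m + 3 ≤ q := by rw [hm_def]; exact_mod_cast hm
  have ha := single_arith (q := (q : ℚ)) hm0 (by linarith)
  have hq1 : (0 : ℚ) < (q : ℚ) + 1 := by positivity
  have hc : (0 : ℚ) < (q : ℚ) + 1 - m := by linarith
  have hkey : 1 / (4 * ((q : ℚ) + 1)) ≤ ((q : ℚ) + 1 - m - 3) / (((q : ℚ) + 1 - m) * ((q : ℚ) + 1)) := by
    rw [div_le_div_iff₀ (by positivity) (by positivity)]
    nlinarith [mul_nonneg (sub_nonneg.2 hmq) hq1.le]
  linarith

/-- **Eight non-triangle points give `(★)`.** -/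
theorem rec_ge_of_eight_nontriangle (hs : Simple M) {G B : Finset α} {q : ℕ} (hG : G ⊆ gr M)
    (hrG : M.eRk (G : Set α) = (q : ℕ∞)) (hB : B ∈ Bq M G q) (hq : 1 ≤ q) {P : Finset α} (hP : P ⊆ G \ B)
    (hnt : ∀ x ∈ P, mTr M (insert x B) + 3 ≤ q) (h8 : 8 ≤ P.card) : 2 / ((q : ℚ) + 1) ≤ rec M G q B := by
  set f : Finset α → ℚ := fun S => surplus M G q S / (bIn M G q S : ℚ) with hf
  have hf0 : ∀ S ∈ (SNq M G q).filter (fun S : Finset α => B ⊆ S), 0 ≤ f S := by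
    intro S hS
    have hS' := (Finset.mem_filter.1 hS).1
    apply div_nonneg (surplus_nonneg hs hG hrG hS')
    positivity
  have hTsub : P.image (fun a => insert a B) ⊆ (SNq M G q).filter (fun S : Finset α => B ⊆ S) := by
    intro S hS
    rw [Finset.mem_image] at hS
    obtain ⟨a, ha, rfl⟩ := hS
    exact Finset.mem_filter.2 ⟨(insert_mem_SNq hrG hB (hP ha)).1, Finset.subset_insert a B⟩
  have hinj : Set.InjOn (fun a => insert a B) (P : Set α) := by
    intro a ha b _ hab
    exact eq_of_insert_eq (Finset.mem_sdiff.1 (hP (Finset.mem_coe.1 ha))).2 hab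
  have hrec : ∑ S ∈ P.image (fun a => insert a B), f S ≤ rec M G q B := by
    unfold rec
    apply Finset.sum_le_sum_of_subset_of_nonneg hTsub
    intro S hS _
    exact hf0 S hS
  rw [Finset.sum_image hinj] at hrec
  have hterm : ∀ a ∈ P, 1 / (4 * ((q : ℚ) + 1)) ≤ f (insert a B) := fun a ha =>
    nontriangle_term_ge hs hG hrG hB hq (hP ha) (hnt a ha)
  have hsum := Finset.card_nsmul_le_sum P _ _ hterm
  rw [nsmul_eq_mul] at hsum
  have h8' : (8 : ℚ) ≤ P.card := by exact_mod_cast h8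
  have hq1 : (0 : ℚ) < (q : ℚ) + 1 := by positivity
  have hkey : 2 / ((q : ℚ) + 1) = 8 * (1 / (4 * ((q : ℚ) + 1))) := by
    rw [mul_one_div, div_eq_div_iff (by positivity) (by positivity)]
    ring
  have h2 : 8 * (1 / (4 * ((q : ℚ) + 1))) ≤ (P.card : ℚ) * (1 / (4 * ((q : ℚ) + 1))) :=
    mul_le_mul_of_nonneg_right h8' (by positivity)
  rw [hkey]
  simp only [hf] at hrec hsum
  linarith

/-- A mixed pair (`x` a triangle point, `y` a non-triangle point) pays `≥ 1/(12(q + 1))`. -/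
theorem mixed_pair_term_ge (hs : Simple M) {G B : Finset α} {q : ℕ} (hG : G ⊆ gr M)
    (hrG : M.eRk (G : Set α) = (q : ℕ∞)) (hB : B ∈ Bq M G q) (hq : 1 ≤ q) {x y : α} (hx : x ∈ G \ B)
    (hy : y ∈ G \ B) (hxy : x ≠ y) (hmx : mTr M (insert x B) + 2 = q) (hmy : mTr M (insert y B) + 3 ≤ q) :
    1 / (12 * ((q : ℚ) + 1)) ≤ surplus M G q (insert x (insert y B)) / (bIn M G q (insert x (insert y B)) : ℚ) := by
  have h2 := pair_term_ge hs hG hrG hB hq hx hy hxy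
  set mx : ℚ := (mTr M (insert x B) : ℚ) with hmx_def
  set my : ℚ := (mTr M (insert y B) : ℚ) with hmy_def
  have hmx' : mx + 2 = q := by rw [hmx_def]; exact_mod_cast hmx
  have hmy0 : (0 : ℚ) ≤ my := by rw [hmy_def]; positivity
  have hmyq : my + 3 ≤ q := by rw [hmy_def]; exact_mod_cast hmy
  have ha := single_arith (q := (q : ℚ)) hmy0 (by linarith)
  have hq1 : (0 : ℚ) < (q : ℚ) + 1 := by positivity
  have hcy : (0 : ℚ) < (q : ℚ) + 1 - my := by linarith
  have hcx : (q : ℚ) + 1 - mx = 3 := by linarith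
  rw [hcx] at h2
  -- `[q/(1+my) − Φ]/(3 c_y) ≥ (c_y − 3)/(3 c_y (q+1)) ≥ 1/(12(q+1))`
  have h3 : ((q : ℚ) + 1 - my - 3) / (((q : ℚ) + 1 - my) * ((q : ℚ) + 1)) / 3 ≤
      ((q : ℚ) / (1 + my) - ((q : ℚ) + 2) / ((q : ℚ) + 1)) / (3 * ((q : ℚ) + 1 - my)) := by
    calc ((q : ℚ) + 1 - my - 3) / (((q : ℚ) + 1 - my) * ((q : ℚ) + 1)) / 3
        ≤ ((q : ℚ) / (1 + my) - ((q : ℚ) + 2) / ((q : ℚ) + 1)) / ((q : ℚ) + 1 - my) / 3 :=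
          div_le_div_of_nonneg_right ha (by norm_num)
      _ = ((q : ℚ) / (1 + my) - ((q : ℚ) + 2) / ((q : ℚ) + 1)) / (3 * ((q : ℚ) + 1 - my)) := by
          rw [div_div]; ring
  have hkey : 1 / (12 * ((q : ℚ) + 1)) ≤ ((q : ℚ) + 1 - my - 3) / (((q : ℚ) + 1 - my) * ((q : ℚ) + 1)) / 3 := by
    rw [div_div, div_le_div_iff₀ (by positivity) (by positivity)]
    nlinarith [mul_nonneg (sub_nonneg.2 hmyq) hq1.le]
  linarith

/-- **Twenty-four mixed pairs give `(★)`**: if `P` is a set of `2`-subsets `{x, y}` of `G ∖ B` with `x` a triangle point and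
`y` a non-triangle point, `|P| ≥ 24`, then `rec(B) ≥ 2/(q + 1)`. -/
theorem rec_ge_of_mixed_pairs (hs : Simple M) {G B : Finset α} {q : ℕ} (hG : G ⊆ gr M)
    (hrG : M.eRk (G : Set α) = (q : ℕ∞)) (hB : B ∈ Bq M G q) (hq : 1 ≤ q) {P : Finset (Finset α)}
    (hP : P ⊆ (G \ B).powersetCard 2)
    (hmix : ∀ p ∈ P, ∃ x y, x ≠ y ∧ p = {x, y} ∧ mTr M (insert x B) + 2 = q ∧ mTr M (insert y B) + 3 ≤ q)
    (h24 : 24 ≤ P.card) : 2 / ((q : ℚ) + 1) ≤ rec M G q B := by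
  set f : Finset α → ℚ := fun S => surplus M G q S / (bIn M G q S : ℚ) with hf
  have hf0 : ∀ S ∈ (SNq M G q).filter (fun S : Finset α => B ⊆ S), 0 ≤ f S := by
    intro S hS
    have hS' := (Finset.mem_filter.1 hS).1
    apply div_nonneg (surplus_nonneg hs hG hrG hS')
    positivity
  have hmem : ∀ p ∈ P, p ⊆ G \ B ∧ p.card = 2 := fun p hp => by
    have := Finset.mem_powersetCard.1 (hP hp)
    exact ⟨this.1, this.2⟩
  have hinj : Set.InjOn (fun p : Finset α => p ∪ B) (P : Set (Finset α)) := by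
    intro p hp p' hp' heq
    have e : ∀ U ∈ P, (U ∪ B) \ B = U := by
      intro U hU
      rw [Finset.union_sdiff_right, Finset.sdiff_eq_self_iff_disjoint, Finset.disjoint_left]
      intro z hz hzB
      exact (Finset.mem_sdiff.1 ((hmem U hU).1 hz)).2 hzB
    simp only at heq
    rw [← e p (Finset.mem_coe.1 hp), ← e p' (Finset.mem_coe.1 hp'), heq]
  have hTsub : P.image (fun p : Finset α => p ∪ B) ⊆ (SNq M G q).filter (fun S : Finset α => B ⊆ S) := by
    intro S hS
    rw [Finset.mem_image] at hS
    obtain ⟨p, hp, rfl⟩ := hS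
    obtain ⟨x, y, hxy, rfl, -, -⟩ := hmix p hp
    have hx : x ∈ G \ B := (hmem _ hp).1 (by simp)
    have hy : y ∈ G \ B := (hmem _ hp).1 (by simp)
    have e : ({x, y} : Finset α) ∪ B = insert x (insert y B) := by
      ext z
      simp only [Finset.mem_union, Finset.mem_insert, Finset.mem_singleton]
      tauto
    rw [e]
    exact Finset.mem_filter.2 ⟨(insert_insert_mem_SNq hrG hB hx hy hxy).1,
      (Finset.subset_insert y B).trans (Finset.subset_insert x _)⟩
  have hrec : ∑ S ∈ P.image (fun p : Finset α => p ∪ B), f S ≤ rec M G q B := by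
    unfold rec
    apply Finset.sum_le_sum_of_subset_of_nonneg hTsub
    intro S hS _
    exact hf0 S hS
  rw [Finset.sum_image hinj] at hrec
  have hterm : ∀ p ∈ P, 1 / (12 * ((q : ℚ) + 1)) ≤ f (p ∪ B) := by
    intro p hp
    obtain ⟨x, y, hxy, rfl, hmx, hmy⟩ := hmix p hp
    have hx : x ∈ G \ B := (hmem _ hp).1 (by simp)
    have hy : y ∈ G \ B := (hmem _ hp).1 (by simp)
    have e : ({x, y} : Finset α) ∪ B = insert x (insert y B) := by
      ext z
      simp only [Finset.mem_union, Finset.mem_insert, Finset.mem_singleton]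
      tauto
    show 1 / (12 * ((q : ℚ) + 1)) ≤ surplus M G q ({x, y} ∪ B) / (bIn M G q ({x, y} ∪ B) : ℚ)
    rw [e]
    exact mixed_pair_term_ge hs hG hrG hB hq hx hy hxy hmx hmy
  have hsum := Finset.card_nsmul_le_sum P _ _ hterm
  rw [nsmul_eq_mul] at hsum
  have h24' : (24 : ℚ) ≤ P.card := by exact_mod_cast h24
  have hq1 : (0 : ℚ) < (q : ℚ) + 1 := by positivity
  have hkey : 2 / ((q : ℚ) + 1) = 24 * (1 / (12 * ((q : ℚ) + 1))) := by
    rw [mul_one_div, div_eq_div_iff (by positivity) (by positivity)]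
    ring
  have h2 : 24 * (1 / (12 * ((q : ℚ) + 1))) ≤ (P.card : ℚ) * (1 / (12 * ((q : ℚ) + 1))) :=
    mul_le_mul_of_nonneg_right h24' (by positivity)
  rw [hkey]
  simp only [hf] at hrec hsum
  linarith

end PercRepro.Star
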